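import Summits.BirchSwinnertonDyer.BirchSwinnertonDyer.Theorems.ThetaPartnerAtTwoSignedKatoUpToAtTwoOfPubCore
import Summits.BirchSwinnertonDyer.BirchSwinnertonDyer.Theorems.ThetaPartnerAtTwoSignedKatoUpToAtTwoLayerPTOrthFinal
import HarnessLib

/-!
# Route `ThetaPartnerAtTwo` (TP2), cruxes K3 `SignedKatoDivisibilityUpToAtTwo` (stmt-BirchSwinnertonDyer-20308) and K3P′
# `SignedKatoDivisibilityUpToAtTwoOfPub` (stmt-BirchSwinnertonDyer-25631), line `colemanrat` v10 — THE CERTIFICATES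
# «K3 BY NAME ⟸ {Kato 13.4 (2) at 2, GZK, CORE}» and «K3P′ BY NAME ⟸ CORE» (S2 now a theorem)

Width seat `bsd-wall-tp2-p2x-w3` g5 (cell `bsd-wall`). HONEST FRAMING: compositions of landed theorems (no definition, no named fact, no
instance, no `sorry`); CONDITIONAL on the displayed hypotheses; closes nothing; K3/K3P′ are NOT settled and BSD is NOT proved by any of this.

With (S2) `stub_ptOrthLayerTwo` LANDED by the lead (`SignedKatoOffTwo.LayerPTFinal.stub_ptOrthLayerTwo`, p615870: Poitou–Tate orthogonality at a
finite layer/level for the (D-layer) pairings) and (S3′) ⟸ CORE (`NoPTOfCore.layerSideNoPTTwo_of_core`, p615686), the certificate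
`OfPubCore.signedKatoDivisibilityUpToAtTwo_of_contraFact_of_gzk_of_ptOrth_of_core` (p616761) specialises to:
* `OfPubCore.signedKatoDivisibilityUpToAtTwo_of_contraFact_of_gzk_of_core : hK2 → hGZK → CORE → K3` (TP2 decl) — K3 is the two named facts
  `Kato2004.thm13_4_two_lengthAt_fineSelmerDualContra_le_of_isEulerSystemClassTwo`, `rank_eq_analyticRank_of_analyticRank_le_one` and ONE
  published statement CORE away;
* `OfPubCore.signedKatoDivisibilityUpToAtTwoOfPub_of_core : CORE → K3P′` (TP2 decl; the RTT route's copy has a byte-identical body) — the PUB-bound twin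
  K3P′ (= registered skeleton `colemanrat_ofpub` v10-P, single stub CORE = `stub_katoZetaErlTwo`) is EXACTLY CORE away, by name.
CORE (spelled inline below = `hcore` of `…LayerSideNoPTOfCore.lean` = the lead's registered v10 stub `stub_katoZetaErlTwo` verbatim): for THE
`T₂E`-adic local Tate pairing `pair` (pinned by (P1), (P2), (P3) w.r.t. the tree's Weil pairings) on any pinned `𝐇¹_Γ(T₂E)`: some local lift `g`,
plus Honda system `d` and genuine `2`-adic Euler-system class `s` (Kato's zeta element, Thm. 12.5) satisfy the explicit reciprocity law at `2` in
♭-Coleman currency «`ℓ_𝔭(Λ/(Col♭_{g,d}⟨loc s, ·⟩)) ≤ ℓ_𝔭(Λ/(L♭))` at every height-one `𝔭 ∌ 2`» (Kobayashi Thm. 6.3 / Otsuki 2009 read at `p = 2`) — PRINT, not tree.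

References: [Kato2004Asterisque] Thm. 12.5, 13.4 (2), §17.13; [Kobayashi2003] Thm. 6.3, (7.16)–(7.21), Thm. 7.3; [GrossZagier1986]; [Kolyvagin1990].
-/

set_option autoImplicit false
-- the Theorems namespace of this sub repeats the summit name by design (D-0017 nested layout)
set_option linter.dupNamespace false

noncomputable section

open scoped Classical MatrixGroups ModularForm NumberField

open CongruenceSubgroup WeierstrassCurve Field IsDedekindDomain NumberField
  Literature.NumberTheory.GaloisRepresentations
  Literature.NumberTheory.EllipticCurves Literature.NumberTheory.EllipticCurves.ModularForms
  Literature.NumberTheory.EllipticCurves.Module Literature.NumberTheory.EllipticCurves.Rank1Residual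
  Literature.NumberTheory.EllipticCurves.Kobayashi2003 Literature.NumberTheory.EllipticCurves.Kato2004
  Literature.NumberTheory.EllipticCurves.Kato2004.EulerSystemValues Literature.NumberTheory.EllipticCurves.GreenbergSelmer
  Literature.NumberTheory.EllipticCurves.Sprung2012
  ZpExtension Summit.BirchSwinnertonDyer.Rank1Residual.Supersingular

namespace Summit.BirchSwinnertonDyer.BirchSwinnertonDyer.Theorems.SignedKatoOffTwo.OfPubCore

/-- **K3 BY NAME ⟸ {Kato Thm. 13.4 (2) at `2`, GZK, CORE}.** Hypotheses: (1) `Kato2004.thm13_4_two_lengthAt_fineSelmerDualContra_le_of_isEulerSystemClassTwo`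
(print-exact, contragredient fine dual; unproved in the tree); (2) `rank_eq_analyticRank_of_analyticRank_le_one` (Gross–Zagier–Kolyvagin; unproved in
the tree); (3) CORE (the published core of (S3′), ON THE local Tate pairing). Conclusion: the crux `SignedKatoDivisibilityUpToAtTwo` of route TP2.
Proof: `signedKatoDivisibilityUpToAtTwo_of_contraFact_of_gzk_of_ptOrth_of_core` with (S2) := `LayerPTFinal.stub_ptOrthLayerTwo` (lead g5, landed).
CONDITIONAL on (1)–(3); closes nothing by itself; BSD is not proved by this. [cite: Kato2004Asterisque, Thm. 13.4 (2) (p. 226), Thm. 12.5 (p. 222), §17.13 (p. 279)]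
[cite: Kobayashi2003, Thm. 6.3 (p. 11), (7.16)–(7.21) (p. 12), Thm. 7.3 (pp. 12–13)] [cite: GrossZagier1986, Thm. I.6.3] [cite: Kolyvagin1990, Thm. A] -/
theorem signedKatoDivisibilityUpToAtTwo_of_contraFact_of_gzk_of_core
    (hK2 : Kato2004.thm13_4_two_lengthAt_fineSelmerDualContra_le_of_isEulerSystemClassTwo)
    (hGZK : rank_eq_analyticRank_of_analyticRank_le_one)
    (hcore :
      ∀ (v : HeightOneSpectrum (𝓞 ℚ)), ((2 : ℕ) : 𝓞 ℚ) ∈ v.asIdeal →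
      ∀ (W : WeierstrassCurve ℚ) [W.IsElliptic] [W.IsGloballyMinimal],
        ¬ W.HasCM → W.analyticRank = 0 → GoodSS W 2 → W.frobeniusTrace 2 = 0 →
        ∀ (κ : ZpExtension ℚ 2) (γ : Field.absoluteGaloisGroup ℚ) (hκ : κ.IsCyclotomic),
          κ.IsTopGenerator γ → IsCyclotomicVariable 2 γ →
          ∀ [NeZero (W.conductorNorm ℤ)] (f : CuspForm (Gamma0 (W.conductorNorm ℤ)) 2),
            IsNewformOf W f → ∀ (ϖ : ℚ), (ϖ : ℝ) * W.realPeriodRat = plusPeriod f →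
          ∀ (Lplus Lminus : IwasawaAlgebra 2), IsPollackPair f 2 Lplus Lminus →
          ∀ [ContinuousSMul ℤ_[2] (W.tateModule 2)] [Module.Free ℤ_[2] (W.tateModule 2)]
            [Module.Finite ℤ_[2] (W.tateModule 2)],
          ∀ 𝔭 : PrimeSpectrum (IwasawaAlgebra 2), 𝔭.asIdeal.height = 1 →
            PowerSeries.C (2 : ℤ_[2]) ∉ 𝔭.asIdeal →
          ∀ (I : Kato2004.IwasawaH1Data W 2 κ γ)
            (pair : ∀ n : ℕ, H1 (tateRep W 2) (κ.layerSubgroup n) →ₗ[ℤ_[2]]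
              (localLayerPointsOfEmb κ (closureEmb (K := ℚ) (v.adicCompletion ℚ)) W n →+ ℤ_[2])),
            -- (P1) projection formula
            (∀ (n : ℕ) (x : H1 (tateRep W 2) (κ.layerSubgroup (n + 1))) (Q : localPoints W (v.adicCompletion ℚ))
              (hQ : Q ∈ localLayerPointsOfEmb κ (closureEmb (K := ℚ) (v.adicCompletion ℚ)) W n),
              pair n (layerCores (tateRep W 2) κ n x) ⟨Q, hQ⟩ =
                pair (n + 1) x ⟨Q, localLayerPointsOfEmb_mono κ (closureEmb (K := ℚ) (v.adicCompletion ℚ)) W (Nat.le_succ n) hQ⟩) →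
            -- (P2) Galois invariance, for EVERY `g ∈ Γ_v`
            (∀ (n : ℕ) (g : absoluteGaloisGroup (v.adicCompletion ℚ)) (y : H1 (tateRep W 2) (κ.layerSubgroup n))
              (Q : localPoints W (v.adicCompletion ℚ))
              (hQ : Q ∈ localLayerPointsOfEmb κ (closureEmb (K := ℚ) (v.adicCompletion ℚ)) W n),
              pair n (conjMap (tateRep W 2).toTopRep (κ.layerSubgroup n) (resGalOfEmb (closureEmb (K := ℚ) (v.adicCompletion ℚ)) g) 1 y)
                ⟨g • Q, smul_mem_localLayerPointsOfEmb κ (closureEmb (K := ℚ) (v.adicCompletion ℚ)) W n g hQ⟩ = pair n y ⟨Q, hQ⟩) →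
            -- (P3) `pair` IS the `T₂E`-adic local Tate pairing: residues = the (D-layer) pairings for THE Weil pairings of the tree
            (∀ (n k : ℕ) (x : H1 (tateRep W 2) (κ.layerSubgroup n))
              (Q : localLayerPointsOfEmb κ (closureEmb (K := ℚ) (v.adicCompletion ℚ)) W n),
              PadicInt.toZModPow k (pair n x Q) =
                LayerPairing.layerPairingPk W κ v (LayerPairing.weilTowerPk W) (LayerPairing.weilTowerPk_pow W)
                  (LayerPairing.weilTowerPk_add_left W) (LayerPairing.weilTowerPk_add_right W) (LayerPairing.weilTowerPk_smul W)
                  n k x Q) →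
          ∃ (g : absoluteGaloisGroup (v.adicCompletion ℚ))
            (_ : κ.IsTopGenerator (resGalOfEmb (closureEmb (K := ℚ) (v.adicCompletion ℚ)) g))
            (d : ℕ → localPoints W (v.adicCompletion ℚ)) (s : I.H),
            (∀ n, d n ∈ localLayerPointsOfEmb κ (closureEmb (K := ℚ) (v.adicCompletion ℚ)) W n) ∧
            (∀ n, localTraceOfEmb κ (closureEmb (K := ℚ) (v.adicCompletion ℚ)) W (n + 1) (n + 2) (d (n + 2)) = -d n) ∧
            (∀ n : ℕ, 1 ≤ n → ∀ P ∈ localLayerPointsOfEmb κ (closureEmb (K := ℚ) (v.adicCompletion ℚ)) W n,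
              ∃ B ∈ AddSubgroup.closure (Set.range fun σ : absoluteGaloisGroup (v.adicCompletion ℚ) ↦ σ • d n),
                ∃ P' ∈ localLayerPointsOfEmb κ (closureEmb (K := ℚ) (v.adicCompletion ℚ)) W (n - 1),
                ∃ R ∈ localLayerPointsOfEmb κ (closureEmb (K := ℚ) (v.adicCompletion ℚ)) W n, P = B + P' + 2 • R) ∧
            (∀ P ∈ localLayerPointsOfEmb κ (closureEmb (K := ℚ) (v.adicCompletion ℚ)) W 0,
              ∃ a : ℤ, ∃ R ∈ localLayerPointsOfEmb κ (closureEmb (K := ℚ) (v.adicCompletion ℚ)) W 0, P = a • d 0 + 2 • R) ∧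
            Kato2004.IsEulerSystemClassTwo W hκ I s ∧
            (∀ col₀ : I.H →+ (localTowerPointsOfEmb κ (closureEmb (K := ℚ) (v.adicCompletion ℚ)) W →+ ℤ_[2]),
              (∀ (n : ℕ) (x : I.H) (Q : localPoints W (v.adicCompletion ℚ)) (hQ : Q ∈ localLayerPointsOfEmb κ (closureEmb (K := ℚ) (v.adicCompletion ℚ)) W n),
                col₀ x ⟨Q, localLayerPointsOfEmb_le_localTowerPointsOfEmb κ (closureEmb (K := ℚ) (v.adicCompletion ℚ)) W n hQ⟩ = pair n (I.proj n x) ⟨Q, hQ⟩) →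
              ∀ Ls Lf : IwasawaAlgebra 2, IsColemanPair κ (closureEmb (K := ℚ) (v.adicCompletion ℚ)) W 0 g d (col₀ s) Ls Lf →
                lengthAt (IwasawaAlgebra 2) (IwasawaAlgebra 2 ⧸ Ideal.span {Lf}) 𝔭 ≤
                  lengthAt (IwasawaAlgebra 2) (IwasawaAlgebra 2 ⧸ Ideal.span {kobayashiL 1 Lplus Lminus}) 𝔭)) :
    Summit.BirchSwinnertonDyer.BirchSwinnertonDyer.Theses.ThetaPartnerAtTwo.SignedKatoDivisibilityUpToAtTwo :=
  signedKatoDivisibilityUpToAtTwo_of_contraFact_of_gzk_of_ptOrth_of_core hK2 hGZK LayerPTFinal.stub_ptOrthLayerTwo hcore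

/-- **K3P′ BY NAME ⟸ CORE** (the PUB-bound twin: K3 under its two published antecedents). Hypothesis: CORE. Conclusion:
`Theses.ThetaPartnerAtTwo.SignedKatoDivisibilityUpToAtTwoOfPub`. CONDITIONAL on CORE; closes nothing by itself.
[cite: Kato2004Asterisque, Thm. 13.4 (2) (p. 226), Thm. 12.5 (p. 222), §17.13 (p. 279)] [cite: Kobayashi2003, Thm. 6.3 (p. 11), Thm. 7.3 (pp. 12–13)] -/
theorem signedKatoDivisibilityUpToAtTwoOfPub_of_core
    (hcore :
      ∀ (v : HeightOneSpectrum (𝓞 ℚ)), ((2 : ℕ) : 𝓞 ℚ) ∈ v.asIdeal →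
      ∀ (W : WeierstrassCurve ℚ) [W.IsElliptic] [W.IsGloballyMinimal],
        ¬ W.HasCM → W.analyticRank = 0 → GoodSS W 2 → W.frobeniusTrace 2 = 0 →
        ∀ (κ : ZpExtension ℚ 2) (γ : Field.absoluteGaloisGroup ℚ) (hκ : κ.IsCyclotomic),
          κ.IsTopGenerator γ → IsCyclotomicVariable 2 γ →
          ∀ [NeZero (W.conductorNorm ℤ)] (f : CuspForm (Gamma0 (W.conductorNorm ℤ)) 2),
            IsNewformOf W f → ∀ (ϖ : ℚ), (ϖ : ℝ) * W.realPeriodRat = plusPeriod f →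
          ∀ (Lplus Lminus : IwasawaAlgebra 2), IsPollackPair f 2 Lplus Lminus →
          ∀ [ContinuousSMul ℤ_[2] (W.tateModule 2)] [Module.Free ℤ_[2] (W.tateModule 2)]
            [Module.Finite ℤ_[2] (W.tateModule 2)],
          ∀ 𝔭 : PrimeSpectrum (IwasawaAlgebra 2), 𝔭.asIdeal.height = 1 →
            PowerSeries.C (2 : ℤ_[2]) ∉ 𝔭.asIdeal →
          ∀ (I : Kato2004.IwasawaH1Data W 2 κ γ)
            (pair : ∀ n : ℕ, H1 (tateRep W 2) (κ.layerSubgroup n) →ₗ[ℤ_[2]]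
              (localLayerPointsOfEmb κ (closureEmb (K := ℚ) (v.adicCompletion ℚ)) W n →+ ℤ_[2])),
            -- (P1) projection formula
            (∀ (n : ℕ) (x : H1 (tateRep W 2) (κ.layerSubgroup (n + 1))) (Q : localPoints W (v.adicCompletion ℚ))
              (hQ : Q ∈ localLayerPointsOfEmb κ (closureEmb (K := ℚ) (v.adicCompletion ℚ)) W n),
              pair n (layerCores (tateRep W 2) κ n x) ⟨Q, hQ⟩ =
                pair (n + 1) x ⟨Q, localLayerPointsOfEmb_mono κ (closureEmb (K := ℚ) (v.adicCompletion ℚ)) W (Nat.le_succ n) hQ⟩) →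
            -- (P2) Galois invariance, for EVERY `g ∈ Γ_v`
            (∀ (n : ℕ) (g : absoluteGaloisGroup (v.adicCompletion ℚ)) (y : H1 (tateRep W 2) (κ.layerSubgroup n))
              (Q : localPoints W (v.adicCompletion ℚ))
              (hQ : Q ∈ localLayerPointsOfEmb κ (closureEmb (K := ℚ) (v.adicCompletion ℚ)) W n),
              pair n (conjMap (tateRep W 2).toTopRep (κ.layerSubgroup n) (resGalOfEmb (closureEmb (K := ℚ) (v.adicCompletion ℚ)) g) 1 y)
                ⟨g • Q, smul_mem_localLayerPointsOfEmb κ (closureEmb (K := ℚ) (v.adicCompletion ℚ)) W n g hQ⟩ = pair n y ⟨Q, hQ⟩) →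
            -- (P3) `pair` IS the `T₂E`-adic local Tate pairing: residues = the (D-layer) pairings for THE Weil pairings of the tree
            (∀ (n k : ℕ) (x : H1 (tateRep W 2) (κ.layerSubgroup n))
              (Q : localLayerPointsOfEmb κ (closureEmb (K := ℚ) (v.adicCompletion ℚ)) W n),
              PadicInt.toZModPow k (pair n x Q) =
                LayerPairing.layerPairingPk W κ v (LayerPairing.weilTowerPk W) (LayerPairing.weilTowerPk_pow W)
                  (LayerPairing.weilTowerPk_add_left W) (LayerPairing.weilTowerPk_add_right W) (LayerPairing.weilTowerPk_smul W)
                  n k x Q) →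
          ∃ (g : absoluteGaloisGroup (v.adicCompletion ℚ))
            (_ : κ.IsTopGenerator (resGalOfEmb (closureEmb (K := ℚ) (v.adicCompletion ℚ)) g))
            (d : ℕ → localPoints W (v.adicCompletion ℚ)) (s : I.H),
            (∀ n, d n ∈ localLayerPointsOfEmb κ (closureEmb (K := ℚ) (v.adicCompletion ℚ)) W n) ∧
            (∀ n, localTraceOfEmb κ (closureEmb (K := ℚ) (v.adicCompletion ℚ)) W (n + 1) (n + 2) (d (n + 2)) = -d n) ∧
            (∀ n : ℕ, 1 ≤ n → ∀ P ∈ localLayerPointsOfEmb κ (closureEmb (K := ℚ) (v.adicCompletion ℚ)) W n,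
              ∃ B ∈ AddSubgroup.closure (Set.range fun σ : absoluteGaloisGroup (v.adicCompletion ℚ) ↦ σ • d n),
                ∃ P' ∈ localLayerPointsOfEmb κ (closureEmb (K := ℚ) (v.adicCompletion ℚ)) W (n - 1),
                ∃ R ∈ localLayerPointsOfEmb κ (closureEmb (K := ℚ) (v.adicCompletion ℚ)) W n, P = B + P' + 2 • R) ∧
            (∀ P ∈ localLayerPointsOfEmb κ (closureEmb (K := ℚ) (v.adicCompletion ℚ)) W 0,
              ∃ a : ℤ, ∃ R ∈ localLayerPointsOfEmb κ (closureEmb (K := ℚ) (v.adicCompletion ℚ)) W 0, P = a • d 0 + 2 • R) ∧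
            Kato2004.IsEulerSystemClassTwo W hκ I s ∧
            (∀ col₀ : I.H →+ (localTowerPointsOfEmb κ (closureEmb (K := ℚ) (v.adicCompletion ℚ)) W →+ ℤ_[2]),
              (∀ (n : ℕ) (x : I.H) (Q : localPoints W (v.adicCompletion ℚ)) (hQ : Q ∈ localLayerPointsOfEmb κ (closureEmb (K := ℚ) (v.adicCompletion ℚ)) W n),
                col₀ x ⟨Q, localLayerPointsOfEmb_le_localTowerPointsOfEmb κ (closureEmb (K := ℚ) (v.adicCompletion ℚ)) W n hQ⟩ = pair n (I.proj n x) ⟨Q, hQ⟩) →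
              ∀ Ls Lf : IwasawaAlgebra 2, IsColemanPair κ (closureEmb (K := ℚ) (v.adicCompletion ℚ)) W 0 g d (col₀ s) Ls Lf →
                lengthAt (IwasawaAlgebra 2) (IwasawaAlgebra 2 ⧸ Ideal.span {Lf}) 𝔭 ≤
                  lengthAt (IwasawaAlgebra 2) (IwasawaAlgebra 2 ⧸ Ideal.span {kobayashiL 1 Lplus Lminus}) 𝔭)) :
    Summit.BirchSwinnertonDyer.BirchSwinnertonDyer.Theses.ThetaPartnerAtTwo.SignedKatoDivisibilityUpToAtTwoOfPub :=
  fun hK2 hGZK ↦ signedKatoDivisibilityUpToAtTwo_of_contraFact_of_gzk_of_core hK2 hGZK hcore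

end Summit.BirchSwinnertonDyer.BirchSwinnertonDyer.Theorems.SignedKatoOffTwo.OfPubCore

end
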